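import Summits.Parity.GeneralizedHardyLittlewood.Theses.LiouvilleMAD
import Summits.Parity.GeneralizedHardyLittlewood.Theses.LiouvilleShiftedTables
import Summits.Parity.GeneralizedHardyLittlewood.Theorems.LiouvilleMADEngineToGHL
import Literature.Barriers.Parity.SiegelZeroDichotomy

/-!
# Crux `EngineToGHL` (stmt-Parity-14995) — crux-ideate round 2, ideator 5: calibration sketch

No idea card is filed by this seat (see `IdeatorMemo5.md`): the crux is kernel-equivalent to
`PairsHL → DimOne` (tree `engineToGHL_iff_pairsHL_imp_dimOne`) and its hypothesis `PairsHL` is inert.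
This file only records, kernel-checked, the three small calibrations the memo adds to the existing
census (9389 `IdeatorMemo1–3`, this crux's `Disproof.lean` §5):

* §1 `toy_pairs_do_not_determine_slopes`, `toy_pairs_do_not_determine_classes` — model-level
  inertness of ALL-shift pair data for the SLOPE sector `(n, 2n+1)` and the CLASS sector (pairs in a
  residue class), complementing the 9389 toy `toy_pairs_do_not_determine_triples` (sector `k ≥ 3`).
* §2 `EffectivePairsHL` — the pair asymptotic with POLYNOMIAL effectivity in the shift
  (`N ≥ h^A`), and the named target `EffectivePairsHLRefutedByUSZ` for the standing disprover:
  modulo the vendored Matomäki–Merikoski Theorem 1.3 (`MatomakiMerikoski2023_pairCorrelation`, any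
  `X = q^V`, `V ≥ 10`; correction factor `2` at `h = 2q`), `UnboundedSiegelZeros → ¬EffectivePairsHL`
  (take `V = max 10 (2A)`, `h = 2q`, `X = q^V ≥ h^A`). So the Landau–Siegel content of conjunct 5
  starts exactly at polynomial effectivity of its hypothesis in the shift; the typed `PairsHL`
  (`∀ h ∃ N₀(h)`) is Siegel-consistent only through an ineffective `N₀(h)` — which is what the route's
  engine delivers anyway (Siegel–Walfisz inside BV-for-λ and EH). [folklore]
-/

namespace Summit.Parity.GeneralizedHardyLittlewood.Cruxes.EngineToGHL.Ideator5

open Finset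

/-! ## §1 Toys: all-shift pair data determine neither slope-2 correlations nor class-restricted pair sums -/

/-- A period-5 nonnegative weight … -/
def w5 : List ℕ := [1, 1, 1, 1, 3]
/-- … and its time reversal `n ↦ w5 (−n mod 5)`. [folklore] -/
def w5r : List ℕ := [1, 3, 1, 1, 1]

/-- Cyclic evaluation with period 5. [folklore] -/
def cyc5 (l : List ℕ) (n : ℕ) : ℕ := l.getD (n % 5) 0

/-- Cyclic pair sum `∑_{n mod 5} w(n) w(n+h)`. [folklore] -/
def pairSum5 (l : List ℕ) (h : ℕ) : ℕ := ((List.range 5).map fun n => cyc5 l n * cyc5 l (n + h)).sum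

/-- Cyclic slope-2 sum `∑_{n mod 5} w(n) w(2n+1)` (the `(n, 2n+1)` = Sophie Germain shape). [folklore] -/
def slopeTwoSum5 (l : List ℕ) : ℕ := ((List.range 5).map fun n => cyc5 l n * cyc5 l (2 * n + 1)).sum

/-- **Pair data do not determine slope-2 data** (model level): `w5` and its reversal have identical
cyclic pair sums at EVERY shift, but slope-2 sums `13 ≠ 9`. [folklore] -/
theorem toy_pairs_do_not_determine_slopes :
    (∀ h ∈ List.range 5, pairSum5 w5 h = pairSum5 w5r h) ∧ slopeTwoSum5 w5 = 13 ∧ slopeTwoSum5 w5r = 9 := by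
  decide

/-- A period-6 nonnegative weight and its translate by one. [folklore] -/
def w6 : List ℕ := [1, 1, 1, 1, 1, 3]
/-- The translate. [folklore] -/
def w6t : List ℕ := [1, 1, 1, 1, 3, 1]

/-- Cyclic evaluation with period 6. [folklore] -/
def cyc6 (l : List ℕ) (n : ℕ) : ℕ := l.getD (n % 6) 0

/-- Cyclic pair sum with period 6. [folklore] -/
def pairSum6 (l : List ℕ) (h : ℕ) : ℕ := ((List.range 6).map fun n => cyc6 l n * cyc6 l (n + h)).sum

/-- Pair sum at shift 2 restricted to the class `n ≡ 0 (mod 2)` ("pairs in a progression"). [folklore] -/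
def classPairSum6 (l : List ℕ) : ℕ :=
  (((List.range 6).filter fun n => n % 2 = 0).map fun n => cyc6 l n * cyc6 l (n + 2)).sum

/-- **Pair data do not determine class-restricted pair data** (model level; pair data are
translation-invariant, class data are not): identical cyclic pair sums at every shift, class sums
`3 ≠ 7`. [folklore] -/
theorem toy_pairs_do_not_determine_classes :
    (∀ h ∈ List.range 6, pairSum6 w6 h = pairSum6 w6t h) ∧ classPairSum6 w6 = 3 ∧ classPairSum6 w6t = 7 := by
  decide

/-! ## §2 The effectivity boundary of the hypothesis of conjunct 5 -/

/-- `PairsHL` with POLYNOMIAL effectivity in the shift: for every `ε > 0` there are an exponent `A`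
and a threshold `N₁` (independent of `h`) such that `|∑_{n ≤ N} Λ(n)Λ(n+h) − 𝔖({0,h})N| ≤ εN` for all
`h ≥ 1` and all `N ≥ max(N₁, h^A)`. Strictly between the typed `PairsHL` (`∀ h ∃ N₀(h)`, implied by
this) and the shift-uniform form refuted in the tree (`EngineToPairs.Negative.not_uniform_in_shift`,
witness `h = (N!)²`). [folklore] -/
def EffectivePairsHL : Prop :=
  ∀ ε : ℝ, 0 < ε → ∃ A N₁ : ℕ, ∀ h : ℕ, 1 ≤ h → ∀ N : ℕ, N₁ ≤ N → h ^ A ≤ N →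
    |(∑ n ∈ Finset.Icc 1 N, ArithmeticFunction.vonMangoldt n * ArithmeticFunction.vonMangoldt (n + h)) -
        Literature.NumberTheory.Sieve.singularSeries ({0, (h : ℤ)} : Finset ℤ) * N| ≤ ε * N

/-- `EffectivePairsHL → PairsHL` (pure logic: fix `h`, take `N₀ = max N₁ (h^A)`), so the effective form
is a genuine strengthening of the hypothesis of conjunct 5. [folklore] -/
theorem pairsHL_bound_of_effective (hE : EffectivePairsHL) :
    ∀ ε : ℝ, 0 < ε → ∀ h : ℕ, 1 ≤ h → ∃ N₀ : ℕ, ∀ N : ℕ, N₀ ≤ N →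
      |(∑ n ∈ Finset.Icc 1 N, ArithmeticFunction.vonMangoldt n * ArithmeticFunction.vonMangoldt (n + h)) -
          Literature.NumberTheory.Sieve.singularSeries ({0, (h : ℤ)} : Finset ℤ) * N| ≤ ε * N := by
  intro ε hε h hh
  obtain ⟨A, N₁, hA⟩ := hE ε hε
  refine ⟨max N₁ (h ^ A), fun N hN => hA h hh N ?_ ?_⟩
  · exact le_trans (le_max_left _ _) hN
  · exact le_trans (le_max_right _ _) hN

/-- TARGET for the standing disprover (named, not proved here): modulo Matomäki–Merikoski Thm 1.3,
Siegel zeros of unbounded quality refute `EffectivePairsHL`. Sketch: given `ε = 1/2 ↦ (A, N₁)`, pick an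
exceptional `(q, χ, η)` with `q ≥ max N₁ q₀`, `η ≥ η₀`; put `V = max 10 (2A)`, `X = q^V` (a natural
number, `X ≥ (2q)^A` since `q^{V−A} ≥ q^A ≥ 2^A`), `h = 2q ≤ X`. Then `φ(2^r) ∣ 2q`, `(−1)^{2q/φ(2^r)} = 1`
and the product over `p ∣ q', p ∤ 2q` is empty, so MM gives `∑_{n≤X} Λ(n)Λ(n+2q) ≥ 2X𝔖_{2q} − err`,
`err ≤ K (h/φ(h)) X (e^{−C√(V log η)} + e^{−C (log X)^{3/5−ε'}} + V log⁶η/η) ≤ 𝔖_{2q} X/10` for `η, q`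
large (as `𝔖_{2q} ≥ C₂ · 2q/φ(2q)`, 9389 Disproof §4), against `≤ X𝔖_{2q} + X/2` from
`EffectivePairsHL`; contradiction since `𝔖_{2q} ≥ 2C₂ > 1.3`. [cite: MatomakiMerikoski2023, Theorem 1.3] -/
def EffectivePairsHLRefutedByUSZ : Prop :=
  Literature.Barriers.Parity.MatomakiMerikoski2023_pairCorrelation →
    Literature.Barriers.Parity.UnboundedSiegelZeros → ¬ EffectivePairsHL

/-- Consistency check of the frame: the crux is `PairsHL → DimOne` with no hypothesis (tree), so the
effectivity boundary above concerns its HYPOTHESIS, not an extra assumption. [folklore] -/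
example : Theses.LiouvilleMAD.EngineToGHL ↔
    (Theses.LiouvilleShiftedTables.PairsHL → Theses.DicksonFibration.DimOne) :=
  Theorems.EngineToGHL.engineToGHL_iff_pairsHL_imp_dimOne

end Summit.Parity.GeneralizedHardyLittlewood.Cruxes.EngineToGHL.Ideator5
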